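import Mathlib.Analysis.Matrix.Spectrum
import Literature.AlgebraicGeometry.ShimuraVarieties.KudlaRapoport2013.Sec4RelationToShimuraVarieties
import Literature.AlgebraicGeometry.ShimuraVarieties.UnitaryShimuraCanonicalModel
import Literature.NumberTheory.Automorphic.Liu2021.AppendixC.DefC1toC3
import Literature.AlgebraicGeometry.AbelianSchemes.AbelianSchemeOverBase
import Literature.AlgebraicGeometry.ShimuraVarieties.KudlaRapoport2013.Sec2Defs
import Literature.AlgebraicGeometry.ShimuraVarieties.KudlaRapoport2013.Sec3ComplexUniformization
import HarnessLib

/-!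
# Kudla–Rapoport 2013, §4.2–§4.4: the up-to-isogeny moduli problem `Sh^V_K`, Proposition 4.3, Proposition 4.4 and the
# Galois action on `π₀(Sh^V_K)` — AS PRINTED over a posited Shimura datum (named facts, no proofs)

[KudlaRapoport2013] = S. Kudla, M. Rapoport, *Special cycles on unitary Shimura varieties II: global theory*, J. reine
angew. Math. **697** (2014) = arXiv 0912.3758; numbering and pins «(arXiv v2 p. N)» from the squad's v2 page text
(`T/KR/TKR-t02/g0/KR2013-arXivv2-pages.txt`, ruling R-1), formulas from the held v1 TeX `paper:arxiv-0912.3758` chunks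
p0014–p0016 (§4 numbering identical in v1 and v2).  This is the SECOND §4 file (squad TKR follow-up deal «block 1b»): the
first, `Sec4RelationToShimuraVarieties` (landed), carries the group-theoretic content of §4.1∕§4.4 (`GU`, `SU`, `ν°`, `ρ`,
`T(𝔸_f)`, `T(ℚ)⁰`, (4.5) as a predicate) and the completeness census of §4; here the items it recorded as «not typed» for
want of a carrier are typed over ONE posited datum `Sec4Data k` (pattern of the tree's `Liu2021.AppendixC.HermSpace.ShimuraSystem`
and `RapoportSmithlingZhang2020.Sec3IntegralModels.Sec3Data`): §4.2 (the groupoid `Sh^V_K(S)` and Remark 4.2),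
Proposition 4.3, Proposition 4.4, and the §4.4 description of the Galois action on `π₀(Sh^V_K)`.  These are exactly the rows
[RapoportSmithlingZhang2020Diagonal] cites as «[31, Rem. 4.2]» and «[31, Props. 4.3, 4.4]» (v6 p. 61).

## The posited datum `Sec4Data k` (what is REAL, what is ⟨CARRIER⟩)

REAL (Mathlib ∕ tree): the imaginary quadratic field `k` (`NumberField`, `IsTotallyComplex`, `Algebra.IsQuadraticExtension ℚ k`
— the standing conventions of the companion ★ `KudlaRapoport2013.Sec2Defs`) with its non-trivial automorphism `c = conj ℚ k` (★
`Liu2021.AppendixC.conj`) and the fixed embedding `τ : k → ℂ` (§4 preamble, p. 19); `n ≥ 1`, `0 ≤ r ≤ n`, «when `n > 1` …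
`r(n−r) > 0`»; the hermitian space `V = kⁿ` through its Gram matrix `J` (`(x, y) = (xᶜ)ᵀ J y`), non-degenerate, of signature
`(n−r, r)` at `τ` (counted on the real eigenvalues of the complex hermitian matrix `τ(J)`, Mathlib
`Matrix.IsHermitian.eigenvalues`); `G(𝔸_f) = GU(V)(𝔸_{k,f})` = the landed `GU (c ⊗ 1) J` on Mathlib's `FiniteAdeleRing (𝓞 k) k`
with `c ⊗ 1 = UnitaryGroup.conjFiniteAdele ℚ k c`; levels `K` = subgroups of `GL_n(𝔸_{k,f}) × 𝔸_{k,f}^×` contained in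
`G(𝔸_f)`, open and compact (`Sec4Data.IsLevel`); `O_k`-lattices in `V`, self-duality, `L ⊗ Ẑ ⊂ 𝔸_{k,f}ⁿ` (closure of `L`) —
the squad's ★ `Sec3ComplexUniformization.IsFullLattice ∕ IsSelfDualFor ∕ adelicLattice ∕ glImage` (coordinates, seat TKR-t03;
ED. 3 = unification U-2: this file's local twins were dropped) — and the stabiliser `K_L` (`Sec4Data.stabilizerLevel`); the Artin correspondence `σ ↔ s` between `Aut(ℂ/τk)` and finite
idèles of `k` in KR's normalisation «a local uniformizer corresponds to the inverse of the Frobenius» (p. 22) = the tree's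
★ `UnitaryCanonicalModel.IsArtinCorrespondent k τ s σ` ([Milne2005] (59), `art = rec⁻¹`); the right-hand sides of (4.5)
(`torusRatZeroOdd ∕ torusRatZeroEven ∕ torusFinAdeleEven`, `nuCircOdd ∕ nuCircEven`, landed).
⟨CARRIER⟩ (no Lean vocabulary; meaning = the docstring; a consumer supplies them): the canonical model `Sh^V_K` as a
`k`-scheme (footnote 2 p. 19: for `n` even, `r = n−r` «the base change to `k` of the usual canonical model» over `ℚ`); the
objects `(A, ι, λ, η̄)` of `Sh^V_K(S)` and their isomorphisms (abelian schemes UP TO ISOGENY,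
`k → End⁰(A)`, rational Tate modules as `π₁(S,s)`-modules and `K`-orbits of level structures have no tree vocabulary —
the abelian scheme `A` itself is a REAL projection, tree ★ `AbelianSchemes.AbelianSchemeOver S`); the classifying map to
`Sh^V_K`; `π₀(Sh^V_K)` with its `Aut(ℂ/E)`-action and the bijection (4.5).  Structural `Prop` fields record only what makes
the carriers meaningful (isomorphism is an equivalence relation; the classifying map is constant on isomorphism classes;
(4.5) is a bijection — (4.5) itself being «standard … cf. [49]», typed as a predicate in the landed file).  Nothing in the
datum asserts a numbered statement of §4; those are the `def KR2013_4_… (D : Sec4Data k) … : Prop` below.  The datum is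
inhabited trivially (empty object carriers, `Sh K = Spec k`, `π₀ K` = the right side of (4.5)), so no predicate below is
vacuously true or false for want of a model.  «`K` sufficiently small» (Prop. 4.3) is READ as «every open compact `K` inside some
open compact `K₀`» — REAL, no carrier.

## Census of this file (v2 pages; the rows of §4 not listed here are in `Sec4RelationToShimuraVarieties`)

| item | disposition |
|---|---|
| §4.2 (pp. 19–20) objects (1)–(3), Rosati condition, (4.2), morphisms; Remark 4.2 (p. 20, (4.3)–(4.4)) | the ⟨CARRIER⟩ fields `Obj`, `ObjIso`, REAL projection `objA`; Remark 4.2 (the level structure read on `H₁(A_s, 𝔸_f)`, independent of `s` and of `Ẑ(1) ≅ Ẑ`) is the MEANING of `Obj`'s level component and has no separate statement. |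
| Proposition 4.3 (p. 20) | `KR2013_4_3_representable` (smooth ∕ quasi-projective scheme for `K` small, naturally `≅` the canonical model: the classifying map is a bijection on isomorphism classes of `S`-points for every `k`-scheme `S`); the DM-stack clause for general `K` and the orbifold clause are not typed (no stacks); the `ℂ`-points clause is (4.1) = [Deligne1979] 2.1.2 (cited in the landed file). |
| Proposition 4.4 (p. 20) + Remark 4.5 (p. 21) | `KR2013_4_4_comparison`: for a self-dual lattice `L` (so `V♯ = (V, [[L]])`, `K♯ = K_L`), a bijection for every `k`-scheme `S` between isomorphism classes of `S`-points of the component `𝓜(n−r,r)^{V♯}` (objects of §2 = companion `Sec2Defs`∕`Sec2GlobalModuliProblem`, entered as PARAMETERS `MObj ∕ MIso ∕ InComp`; `KR2013_4_4_comparison_sec2` (ED. 2) instantiates them on ★ `Sec2Defs`) and of `Sh^V_{K♯}(S)`.  WEAKER-THAN-PRINT (said in the docstring): an isomorphism of stacks gives equivalences of groupoids natural in `S`; typed is the bijection of isomorphism classes for each `S` (no base-change structure on the carriers to state naturality). |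
| §4.4 (p. 22) Galois action on `π₀(Sh^V_K)` via `ρ(x_σ)` | `KR2013_4_4_galoisAction_odd` (`n = 2κ+1`, `E = k`), `KR2013_4_4_galoisAction_even` (`n = 2κ`, `r ≠ n−r`, `E = k`), `KR2013_4_4_galoisAction_evenMiddle` (`n = 2κ`, `r = n−r`, `E = ℚ`, finite idèles of `ℚ` pushed to `𝔸_{k,f}` by ★ `FiniteAdeleRing.baseChange`), all with the landed REAL `rhoOdd ∕ rhoEven ∕ rhoEvenMiddle` and the tree's ★ Artin correspondence. |
| v1-only «Proposition 4.6» (component counts, «We omit the proof»; absent from v2) | not typed (see the landed file's census). |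

DEDUP: `rg 'cite: KudlaRapoport2013, (Proposition 4|Remark 4.2|§4.2)'` = the landed §4 file only; canonical-model carriers in
the tree (`HermSpace.ShimuraSystem` for `U(V)` over a CM extension `E/F`, `UnitaryCanonicalModel.*` for `U(H)`, `n = 3`) are
for UNITARY groups `Res U(V)`, not KR's similitude datum `(GU(V), h)` over `k` — not reused as the carrier, cited as pattern.
No instance, notation, axiom or proof; nothing here asserts that any statement of [KudlaRapoport2013] holds.
-/

universe u

open Matrix CategoryTheory AlgebraicGeometry NumberField IsDedekindDomain Topology
open scoped Matrix

namespace Literature.AlgebraicGeometry.ShimuraVarieties.KudlaRapoport2013.Sec4ShimuraComparison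

open Literature.NumberTheory.Automorphic.UnitaryGroup (conjFiniteAdele)
open Literature.NumberTheory.Automorphic.Liu2021.AppendixC (IsQuasiProjectiveOver conj)
open Literature.NumberTheory.Automorphic (FiniteAdeleRing.baseChange)
open Literature.AlgebraicGeometry.Motives (SchemeOver)
open Literature.AlgebraicGeometry.AbelianSchemes (AbelianSchemeOver)
open Literature.AlgebraicGeometry.ShimuraVarieties.UnitaryCanonicalModel (IsArtinCorrespondent)
open Literature.AlgebraicGeometry.ShimuraVarieties.KudlaRapoport2013.Sec4RelationToShimuraVarieties
  (GU nuCircOdd nuCircEven torusRatZeroOdd torusRatZeroEven torusFinAdeleEven rhoOdd rhoEven rhoEvenMiddle)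
open Literature.AlgebraicGeometry.ShimuraVarieties.KudlaRapoport2013.Sec3ComplexUniformization
  (IsFullLattice IsSelfDualFor adelicLattice glImage)

section Ambient

variable (k : Type) [Field k] [NumberField k]

/-- The ambient group of `G(𝔸_f)`: `GL_n(𝔸_{k,f}) × 𝔸_{k,f}^×` (the landed `GU` is the graph of the multiplier inside
it; §4.1 p. 19 «`K ⊂ G(𝔸_f)`»).  A `Subgroup` of it is what indexes levels below.  REAL abbreviation.
[cite: KudlaRapoport2013, §4.1 (arXiv v2 p. 19)] -/
abbrev Level (n : ℕ) : Type :=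
  Subgroup (GL (Fin n) (FiniteAdeleRing (𝓞 k) k) × (FiniteAdeleRing (𝓞 k) k)ˣ)

/-- The right-hand side of (4.5) for `n = 2κ+1` (p. 21): `T(ℚ)⁰ \ T(𝔸_f) / ν°(K) = 𝔸_{k,f}^× ⧸ (k^× · ν°(K))`, on the
landed REAL `torusRatZeroOdd`, `nuCircOdd` (same expression as in the landed predicate `KR2013_4_5_pi0_odd`).
[cite: KudlaRapoport2013, §4.4 (4.5) (arXiv v2 p. 21)] -/
abbrev Pi0QuotOdd (κ : ℕ) {n : ℕ} (K : Level k n) : Type :=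
  (FiniteAdeleRing (𝓞 k) k)ˣ ⧸
    (torusRatZeroOdd k ⊔ Subgroup.closure (nuCircOdd κ ''
      (K : Set (GL (Fin n) (FiniteAdeleRing (𝓞 k) k) × (FiniteAdeleRing (𝓞 k) k)ˣ))))

/-- The ambient quotient for the right-hand side of (4.5) for `n = 2κ` (p. 21): `(𝔸_{k,f}^× × 𝔸_{k,f}^×) ⧸ (T(ℚ)⁰ · ν°(K))`
with the landed REAL `torusRatZeroEven k c` (`T¹(ℚ) × ℚ^×_{>0}`) and `nuCircEven`; the printed set `T(ℚ)⁰\T(𝔸_f)/ν°(K)`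
is the image of `T(𝔸_f) = torusFinAdeleEven k c` in it (field `pi0QuotEven_range` of the datum).
[cite: KudlaRapoport2013, §4.4 (4.5) (arXiv v2 p. 21)] -/
abbrev Pi0QuotEven (c : k ≃ₐ[ℚ] k) (κ : ℕ) {n : ℕ} (K : Level k n) : Type :=
  ((FiniteAdeleRing (𝓞 k) k)ˣ × (FiniteAdeleRing (𝓞 k) k)ˣ) ⧸
    (torusRatZeroEven k c ⊔ Subgroup.closure (nuCircEven κ ''
      (K : Set (GL (Fin n) (FiniteAdeleRing (𝓞 k) k) × (FiniteAdeleRing (𝓞 k) k)ˣ))))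

/-- The structure map `Spec k → Spec 𝒪_k`, through which a `k`-scheme is an `𝒪_k`-scheme (Proposition 4.4:
`𝓜(n−r,r)^{V♯} ×_{Spec 𝒪_k} Spec k`). REAL. [cite: KudlaRapoport2013, Proposition 4.4 (arXiv v2 p. 20)] -/
noncomputable def specToSpecInt : Spec (.of k) ⟶ Spec (.of (𝓞 k)) :=
  Spec.map (CommRingCat.ofHom (algebraMap (𝓞 k) k))

end Ambient

/-- **The posited datum of §4.2–§4.4** over an imaginary quadratic field `k` (see the module docstring for which fields are
REAL and which are ⟨CARRIER⟩).  Printed sources of the fields: §4 preamble and §4.1 (p. 19: `k`, `τ`, `n`, `r`, `V` of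
signature `(n−r, r)`, `G = GU(V)`, `Sh^V_K` over `k`, footnote 2), §4.2 (pp. 19–20: the objects «`(A, ι, λ, η̄)`, where (1) `A`
is an abelian scheme over `S`, up to isogeny, with an action of `k`, `ι : k → End⁰(A)`, (2) `λ` is a polarization [footnote 3:
an isomorphism in the isogeny category a `ℚ₊^×`-multiple of which is a polarization in the sense of Deligne], (3) `η̄` is a
`K`-level structure, i.e., a `K`-orbit of `k ⊗ 𝔸_f`-linear isomorphisms `η : T(A)⁰ → V(𝔸_f)` such that the polarization form
on `T(A)⁰` and the symplectic form on `V(𝔸_f)` coincide up to a scalar in `𝔸_f^×`», `ι(a)* = ι(aσ)` for the Rosati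
involution, the Kottwitz condition (4.2) `det(T − ι(a) ∣ Lie A) = (T − φ(a))^{n−r}(T − φ(aσ))^r ∈ 𝒪_S[T]`; morphisms «`k`-linear
isogenies `μ : A → A'` carrying `η̄` to `η̄'` and `λ` to a `ℚ₊^×`-multiple of `λ'`. All such morphisms are isomorphisms»),
Remark 4.2 (p. 20: the level structure read on `H₁(A_s, 𝔸_f)` for a geometric point `s` of the connected base, with its
`𝔸_f(1)`-valued alternating form, (4.3) `Ẑ(1) = lim μ_n(k(s))`, a trivialization (4.4) `Ẑ(1) ≅ Ẑ`, `K`-orbits of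
`k ⊗ 𝔸_f`-linear similitudes `H₁(A_s, 𝔸_f) ⥲ V(𝔸_f)` fixed by `π₁(S, s)` — «independent of the choice of the geometric point
`s` and of the trivialization (4.4)»), Proposition 4.3 (p. 20: «`K` sufficiently small», «naturally isomorphic to the canonical
model»), §4.4 (pp. 21–22: `π₀(Sh^V_K)`, (4.5), the action of `Gal(ℚ̄/E)`).  Nothing is asserted by the datum.
[cite: KudlaRapoport2013, §4.1–§4.4 (arXiv v2 pp. 19–22)] -/
structure Sec4Data (k : Type) [Field k] [NumberField k] [IsTotallyComplex k] [Algebra.IsQuadraticExtension ℚ k] :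
    Type 2 where
  /-- «we fix an embedding `τ` of `k` into `ℂ`» (§4 preamble, p. 19). REAL. -/
  τ : k →+* ℂ
  /-- `n = dim_k V` (§4.1). -/
  n : ℕ
  /-- `r`, the signature being `(n−r, r)` (§4.1). -/
  r : ℕ
  /-- `n ≥ 1` (standing). -/
  one_le_n : 1 ≤ n
  /-- `0 ≤ r ≤ n`. -/
  r_le_n : r ≤ n
  /-- «When `n > 1`, we assume that `r(n−r) > 0`» (§4 preamble, p. 19). -/
  r_mul_pos : 1 < n → 0 < r * (n - r)
  /-- the Gram matrix `J` of «a hermitian vector space `V` over `k` of signature `(n−r, r)`» (§4.1) in a basis of `V = kⁿ`,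
  `(x, y) = (xᶜ)ᵀ J y`. REAL. -/
  J : Matrix (Fin n) (Fin n) k
  /-- hermitian: `(Jᶜ)ᵀ = J`. -/
  J_herm : (J.map (conj ℚ k))ᵀ = J
  /-- non-degenerate. -/
  J_det_ne : J.det ≠ 0
  /-- `τ(J)` is a complex hermitian matrix (follows from `J_herm`; carried to name its eigenvalues). -/
  J_hermC : (J.map τ).IsHermitian
  /-- «of signature `(n−r, r)`» at `τ`: `n − r` positive and `r` negative eigenvalues of `τ(J)`. REAL. -/
  sig_eq : (Finset.univ.filter fun i => 0 < J_hermC.eigenvalues i).card = n - r ∧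
    (Finset.univ.filter fun i => J_hermC.eigenvalues i < 0).card = r
  /-- ⟨CARRIER⟩ the Shimura variety ∕ canonical model `Sh^V_K` as a scheme over `k` (§4.1, p. 19: «there is a Shimura variety
  `Sh^V_K` over `k`»; footnote 2: for `n` even and `r = n−r` «the base change to `k` of the usual canonical model»), for an
  open compact `K ⊂ G(𝔸_f)` (meaningful on `IsLevel`; for `K` not small the print's `Sh^V_K` is an orbifold ∕ stack). -/
  Sh : Level k n → SchemeOver k
  /-- ⟨CARRIER⟩ the objects `(A, ι, λ, η̄)` of `Sh^V_K(S)` for a locally noetherian `k`-scheme `f : S → Spec k` (§4.2, pp. 19–20,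
  quoted in the structure docstring; level component per Remark 4.2). -/
  Obj : Level k n → ∀ {S : Scheme.{0}}, (S ⟶ Spec (.of k)) → Type 1
  /-- ⟨CARRIER⟩ the morphisms of `Sh^V_K(S)` as the relation «isomorphic» (§4.2, p. 20: `k`-linear isogenies carrying `η̄` to
  `η̄'` and `λ` to a `ℚ₊^×`-multiple of `λ'`; «All such morphisms are isomorphisms»). -/
  ObjIso : ∀ {K : Level k n} {S : Scheme.{0}} {f : S ⟶ Spec (.of k)}, Obj K f → Obj K f → Prop
  /-- (structural) «isomorphic» is an equivalence relation (a groupoid). -/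
  objIso_equivalence : ∀ (K : Level k n) {S : Scheme.{0}} (f : S ⟶ Spec (.of k)),
    Equivalence (@ObjIso K S f)
  /-- REAL projection: the abelian scheme `A` over `S` underlying an object (§4.2 (1); tree ★ `AbelianSchemeOver S`). -/
  objA : ∀ {K : Level k n} {S : Scheme.{0}} {f : S ⟶ Spec (.of k)}, Obj K f → AbelianSchemeOver S
  /-- ⟨CARRIER⟩ the classifying map of Proposition 4.3 («naturally isomorphic to the canonical model»): an object of
  `Sh^V_K(S)` ↦ an `S`-point of `Sh^V_K` over `k` (meaningful for `K` small). -/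
  pt : ∀ {K : Level k n} {S : Scheme.{0}} {f : S ⟶ Spec (.of k)}, Obj K f → (Over.mk f ⟶ Sh K)
  /-- (structural) the classifying map is constant on isomorphism classes. -/
  pt_objIso : ∀ {K : Level k n} {S : Scheme.{0}} {f : S ⟶ Spec (.of k)} (x y : Obj K f), ObjIso x y → pt x = pt y
  /-- ⟨CARRIER⟩ `π₀(Sh^V_K)`, the set of geometric connected components (§4.4, p. 21). -/
  pi0 : Level k n → Type
  /-- ⟨CARRIER⟩ the action of `σ ∈ Aut(ℂ/E) ⊇ Gal(ℚ̄/E)` on `π₀(Sh^V_K)` (§4.4, p. 22; `E = k`, or `ℚ` when `r = n−r`;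
  meaningful for `σ` fixing `E`). -/
  galAct : ∀ K : Level k n, (ℂ ≃+* ℂ) → pi0 K → pi0 K
  /-- ⟨CARRIER⟩ the bijection (4.5) for `n = 2κ+1`: `π₀(Sh^V_K) ⥲ T(ℚ)⁰\T(𝔸_f)/ν°(K)` (p. 21). -/
  pi0QuotOdd : ∀ (κ : ℕ), n = 2 * κ + 1 → ∀ K : Level k n, pi0 K → Pi0QuotOdd k κ K
  /-- (structural) (4.5) is a bijection, for open compact `K ⊂ G(𝔸_f)` (p. 21; «cf. [49]»). -/
  pi0QuotOdd_bijective : ∀ (κ : ℕ) (h : n = 2 * κ + 1) (K : Level k n),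
    (K : Set _) ⊆ GU (conjFiniteAdele ℚ k (conj ℚ k)) (J.map (algebraMap k (FiniteAdeleRing (𝓞 k) k))) →
    IsOpen (K : Set (GL (Fin n) (FiniteAdeleRing (𝓞 k) k) × (FiniteAdeleRing (𝓞 k) k)ˣ)) →
    IsCompact (K : Set (GL (Fin n) (FiniteAdeleRing (𝓞 k) k) × (FiniteAdeleRing (𝓞 k) k)ˣ)) →
      Function.Bijective (pi0QuotOdd κ h K)
  /-- ⟨CARRIER⟩ the bijection (4.5) for `n = 2κ`, valued in the ambient quotient `Pi0QuotEven` (p. 21). -/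
  pi0QuotEven : ∀ (κ : ℕ), n = 2 * κ → ∀ K : Level k n, pi0 K → Pi0QuotEven k (conj ℚ k) κ K
  /-- (structural) (4.5), `n` even: injective … -/
  pi0QuotEven_injective : ∀ (κ : ℕ) (h : n = 2 * κ) (K : Level k n),
    (K : Set _) ⊆ GU (conjFiniteAdele ℚ k (conj ℚ k)) (J.map (algebraMap k (FiniteAdeleRing (𝓞 k) k))) →
    IsOpen (K : Set (GL (Fin n) (FiniteAdeleRing (𝓞 k) k) × (FiniteAdeleRing (𝓞 k) k)ˣ)) →
    IsCompact (K : Set (GL (Fin n) (FiniteAdeleRing (𝓞 k) k) × (FiniteAdeleRing (𝓞 k) k)ˣ)) →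
      Function.Injective (pi0QuotEven κ h K)
  /-- (structural) … with image the classes of `T(𝔸_f) = T¹(𝔸_f) × 𝔸_{ℚ,f}^×` (landed `torusFinAdeleEven`), i.e. onto
  `T(ℚ)⁰\T(𝔸_f)/ν°(K)`. -/
  pi0QuotEven_range : ∀ (κ : ℕ) (h : n = 2 * κ) (K : Level k n),
    (K : Set _) ⊆ GU (conjFiniteAdele ℚ k (conj ℚ k)) (J.map (algebraMap k (FiniteAdeleRing (𝓞 k) k))) →
    IsOpen (K : Set (GL (Fin n) (FiniteAdeleRing (𝓞 k) k) × (FiniteAdeleRing (𝓞 k) k)ˣ)) →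
    IsCompact (K : Set (GL (Fin n) (FiniteAdeleRing (𝓞 k) k) × (FiniteAdeleRing (𝓞 k) k)ˣ)) →
      Set.range (pi0QuotEven κ h K) =
        QuotientGroup.mk '' (torusFinAdeleEven k (conj ℚ k) : Set ((FiniteAdeleRing (𝓞 k) k)ˣ × (FiniteAdeleRing (𝓞 k) k)ˣ))

namespace Sec4Data

variable {k : Type} [Field k] [NumberField k] [IsTotallyComplex k] [Algebra.IsQuadraticExtension ℚ k]
  (D : Sec4Data k)

/-- `G(𝔸_f) = GU(V)(𝔸_{k,f})` of the datum: the landed `GU` for `σ = c ⊗ 1` (tree `conjFiniteAdele ℚ k c`) and the Gram matrix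
`J` pushed to `𝔸_{k,f}` (§4.1, p. 19). REAL. [cite: KudlaRapoport2013, §4.1 (arXiv v2 p. 19)] -/
noncomputable def Gfin : Set (GL (Fin D.n) (FiniteAdeleRing (𝓞 k) k) × (FiniteAdeleRing (𝓞 k) k)ˣ) :=
  GU (conjFiniteAdele ℚ k (conj ℚ k)) (D.J.map (algebraMap k (FiniteAdeleRing (𝓞 k) k)))

/-- «an open compact subgroup `K ⊂ G(𝔸_f)`» (§4.1, p. 19). REAL predicate on a level of the datum.
[cite: KudlaRapoport2013, §4.1 (arXiv v2 p. 19)] -/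
def IsLevel (K : Level k D.n) : Prop :=
  (K : Set _) ⊆ D.Gfin ∧
    IsOpen (K : Set (GL (Fin D.n) (FiniteAdeleRing (𝓞 k) k) × (FiniteAdeleRing (𝓞 k) k)ˣ)) ∧
    IsCompact (K : Set (GL (Fin D.n) (FiniteAdeleRing (𝓞 k) k) × (FiniteAdeleRing (𝓞 k) k)ˣ))

/-- `K_L = K♯`, «the stabilizer in `G^V(𝔸_f)` of a self-dual lattice» `L` (Proposition 4.4, p. 20), i.e. of `L ⊗ Ẑ` under
`(g, ν) · v = g v`: a REAL subset of `G(𝔸_f)` (a subgroup; typed as a set, closed under the group law by a bookkeeping lemma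
left to a prover seat).  `L ⊗ Ẑ ⊂ 𝔸_{k,f}ⁿ` and `g · Λ` are the squad's ★ `Sec3ComplexUniformization.adelicLattice` ∕ `glImage`
(§3.2, seat TKR-t03: the closure of the diagonal image of `L`; the similitude version of its `K1`) — ED. 3 (unification U-2):
the local twins `Sec4Data.form ∕ IsLattice ∕ IsSelfDualLattice ∕ adelicLattice` of ED. 1–2 are DROPPED for the ★ coordinate defs
`krForm ∕ IsFullLattice ∕ IsSelfDualFor ∕ adelicLattice` of that file (same ambient types `Submodule (𝓞 k) (Fin n → k)`,
`Fin n → FiniteAdeleRing (𝓞 k) k`). [cite: KudlaRapoport2013, Proposition 4.4 (arXiv v2 p. 20)] -/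
def stabilizerLevel (L : Submodule (𝓞 k) (Fin D.n → k)) :
    Set (GL (Fin D.n) (FiniteAdeleRing (𝓞 k) k) × (FiniteAdeleRing (𝓞 k) k)ˣ) :=
  {p | p ∈ D.Gfin ∧ glImage p.1 (adelicLattice L) = adelicLattice L}

end Sec4Data

/-! ## Proposition 4.3 -/

section Prop43

variable {k : Type} [Field k] [NumberField k] [IsTotallyComplex k] [Algebra.IsQuadraticExtension ℚ k]

/-- **Proposition 4.3.**  Printed (p. 20): «`Sh^V_K` is a smooth Deligne–Mumford stack over `Spec k`. For `K` sufficiently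
small, `Sh^V_K` is a quasi-projective scheme over `k`, naturally isomorphic to the canonical model of the Shimura variety
`Sh^V_K`. In particular, if `K` is sufficiently small, the set of `ℂ`-points `Sh^V_K(ℂ)` of `Sh^V_K`, via the fixed embedding
`τ` of `k` into `ℂ`, is canonically identified with the double coset space `Sh^V_K(ℂ)` of (4.1). When `K` is not sufficiently
small, then `Sh^V_K(ℂ)` is canonically identified with the space `[G(ℚ)\D(V) × G(𝔸_f)/K]` viewed as an orbifold.» («A
`p`-integral version … is proved in [27] [= Kottwitz1992], and the proof transposes easily», p. 20.)  TYPED over the datum,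
with «for `K` sufficiently small» READ as «for every open compact `K` contained in some open compact `K₀ ⊂ G(𝔸_f)`» (REAL,
no carrier): the `k`-scheme `Sh^V_K` is smooth over `k` (Mathlib `Smooth`) and quasi-projective over `k` (tree
`IsQuasiProjectiveOver`), and the classifying map `pt` identifies, for every `k`-scheme `S`, the isomorphism classes of
`Sh^V_K(S)` with the `S`-points of `Sh^V_K` (injective on classes and surjective) — the scheme REPRESENTS the moduli groupoid.
Not typed: the DM-stack statement for general `K` and the orbifold clause (no stacks in Lean); the `ℂ`-points clause is (4.1).
[cite: KudlaRapoport2013, Proposition 4.3 (arXiv v2 p. 20)] -/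
def KR2013_4_3_representable (D : Sec4Data k) : Prop :=
  ∃ K₀ : Level k D.n, D.IsLevel K₀ ∧
    ∀ K : Level k D.n, K ≤ K₀ → D.IsLevel K →
      Smooth (D.Sh K).hom ∧ IsQuasiProjectiveOver (D.Sh K) ∧
        ∀ {S : Scheme.{0}} (f : S ⟶ Spec (.of k)),
          (∀ x y : D.Obj K f, D.pt x = D.pt y → D.ObjIso x y) ∧
            Function.Surjective (D.pt (K := K) (S := S) (f := f))

end Prop43

/-! ## Proposition 4.4 (generic fibre of `𝓜(n−r,r)^{V♯}`) -/

section Prop44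

variable {k : Type} [Field k] [NumberField k] [IsTotallyComplex k] [Algebra.IsQuadraticExtension ℚ k]

/-- **Proposition 4.4.**  Printed (p. 20): «Let `V♯ ∈ 𝓡_{(n−r,r)}(k)♯` be a relevant hermitian space. Then there is an
isomorphism of stacks over `k`, `𝓜(n−r,r)^{V♯} ×_{Spec 𝒪_k} Spec k ≃ Sh^V_{K♯}`, where `𝓜(n−r,r)^{V♯}` is the component of
`𝓜(n−r,r)` associated to the strict similarity class of `V♯` in (i) of Proposition 2.19 and `K♯` is the stabilizer in
`G^V(𝔸_f)` of a self-dual lattice in the `G^V_1`-genus given by `V♯`.»  Remark 4.5 (p. 21): «the stacks on both sides of this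
isomorphism depend only on the strict similitude class of `V` and … when `n` is odd, there is only one such class.»  (Proof,
p. 21: `ξ = (A, ι, λ) ↦ (A, ι, λ, η̄)` with `η = j_{𝔸_f}`, `j_{𝔸_f}(T(A)) = L ⊗ Ẑ`; conversely `T(A) = η⁻¹(L ⊗ Ẑ)` and the unique
`a ∈ ℚ₊^×` with `aλ` principal.)  TYPED over the datum for a full self-dual lattice `L ⊂ V = kⁿ` (★ `IsFullLattice`, `IsSelfDualFor (conj) J` of
`Sec3ComplexUniformization`; so `V♯ = (V, [[L]])` and `K♯ = K_L`, REAL `stabilizerLevel`), with the MODULI SIDE AS PARAMETERS — `MObj g` = the objects `(A, ι, λ)` of `𝓜(n−r,r)(S)` over an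
`𝒪_k`-scheme `g : S → Spec 𝒪_k`, `MIso` their isomorphisms, `InComp` = membership in the component `𝓜(n−r,r)^{V♯}` (§2,
companion files `Sec2Defs` ∕ `Sec2GlobalModuliProblem` of this directory supply them) — as: for every `k`-scheme
`f : S → Spec k` there is a bijection between the `MIso`-classes of `{x ∈ MObj(S → Spec k → Spec 𝒪_k) | InComp x}` and the
isomorphism classes of `Sh^V_{K♯}(S)`.  WEAKER-THAN-PRINT: an isomorphism of stacks is an equivalence of groupoids natural
in `S`; the bijection of isomorphism classes for each `S` is what the carriers can state (no base change on them).
[cite: KudlaRapoport2013, Proposition 4.4 (arXiv v2 p. 20)] -/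
def KR2013_4_4_comparison (D : Sec4Data k)
    (MObj : ∀ {S : Scheme.{0}}, (S ⟶ Spec (.of (𝓞 k))) → Type u)
    (MIso : ∀ {S : Scheme.{0}} {g : S ⟶ Spec (.of (𝓞 k))}, MObj g → MObj g → Prop)
    (InComp : ∀ {S : Scheme.{0}} {g : S ⟶ Spec (.of (𝓞 k))}, MObj g → Prop)
    (L : Submodule (𝓞 k) (Fin D.n → k)) : Prop :=
  IsFullLattice L → IsSelfDualFor (conj ℚ k : k →+* k) D.J L →
    ∀ {S : Scheme.{0}} (f : S ⟶ Spec (.of k)),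
      Nonempty
        (Quot (fun x y : {x : MObj (f ≫ specToSpecInt k) // InComp x} => MIso x.1 y.1) ≃
          Quot (@Sec4Data.ObjIso k _ _ _ _ D (Subgroup.closure (D.stabilizerLevel L)) S f))

end Prop44

/-! ## §4.4: the action of `Gal(ℚ̄/E)` on `π₀(Sh^V_K)` -/

section Galois

variable {k : Type} [Field k] [NumberField k] [IsTotallyComplex k] [Algebra.IsQuadraticExtension ℚ k]

/-- **§4.4, the Galois action on `π₀(Sh^V_K)`, `n = 2κ+1` odd** (then `E = k`, `T = Res_{k/ℚ} 𝔾_m`).  Printed (p. 22):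
«the action of `σ ∈ Gal(ℚ̄/E)` on `π₀(Sh^V_K)` is given, on the right side of (4.5), by multiplication by `ρ(x_σ)`, where
`x_σ ∈ 𝔸_E^×` is an element whose image under the Artin reciprocity map is `σ∣E^{ab}`. As in [49], we normalize this map so that
a local uniformizer corresponds to the inverse of the Frobenius.» with «`ρ(a) = (a/ā)^{k−r} a` if `n = 2k+1` is odd» (the
landed REAL `rhoOdd`, on finite idèles with `ā = (c ⊗ 1)(a)`).  TYPED over the datum: for every open compact `K ⊂ G(𝔸_f)`, every
`σ ∈ Aut(ℂ)` and finite idèle `s` of `k` corresponding under the tree's ★ `IsArtinCorrespondent k τ s σ` (= KR's normalisation: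
`art = rec⁻¹`, uniformizer ↦ geometric Frobenius; this forces `σ` to fix `τ(k)`; the archimedean component is irrelevant for `k`
imaginary), and every `x ∈ π₀(Sh^V_K)`: `(4.5)(σ·x) = [ρ(s)] · (4.5)(x)` in `𝔸_{k,f}^× ⧸ (k^× ν°(K))`.
[cite: KudlaRapoport2013, §4.4 (arXiv v2 p. 22)] -/
def KR2013_4_4_galoisAction_odd (D : Sec4Data k) : Prop :=
  ∀ (κ : ℕ) (hn : D.n = 2 * κ + 1) (K : Level k D.n), D.IsLevel K →
    ∀ (σ : ℂ ≃+* ℂ) (s : (FiniteAdeleRing (𝓞 k) k)ˣ), IsArtinCorrespondent k D.τ s σ →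
      ∀ x : D.pi0 K,
        D.pi0QuotOdd κ hn K (D.galAct K σ x) =
          (QuotientGroup.mk (rhoOdd (conjFiniteAdele ℚ k (conj ℚ k)) κ D.r s) : Pi0QuotOdd k κ K) *
            D.pi0QuotOdd κ hn K x

/-- **§4.4, the Galois action on `π₀(Sh^V_K)`, `n = 2κ` even, `r ≠ n − r`** (then `E = k`, `T = T¹ × 𝔾_m`).  Same printed sentence
(p. 22) with «`ρ(a) = ((a/ā)^{k−r}, a ā)` if `n = 2k` is even and `r ≠ n−r`» (the landed REAL `rhoEven`; footnote 4: «In [49], eq.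
(1.15), the exponent `−1` in the first factor should be eliminated»).  TYPED over the datum as in the odd case, in the ambient quotient
`Pi0QuotEven`: `(4.5)(σ·x) = [ρ(s)] · (4.5)(x)`.
[cite: KudlaRapoport2013, §4.4 (arXiv v2 p. 22)] -/
def KR2013_4_4_galoisAction_even (D : Sec4Data k) : Prop :=
  ∀ (κ : ℕ) (hn : D.n = 2 * κ), 2 * D.r ≠ D.n → ∀ (K : Level k D.n), D.IsLevel K →
    ∀ (σ : ℂ ≃+* ℂ) (s : (FiniteAdeleRing (𝓞 k) k)ˣ), IsArtinCorrespondent k D.τ s σ →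
      ∀ x : D.pi0 K,
        D.pi0QuotEven κ hn K (D.galAct K σ x) =
          (QuotientGroup.mk (rhoEven (conjFiniteAdele ℚ k (conj ℚ k)) κ D.r s) : Pi0QuotEven k (conj ℚ k) κ K) *
            D.pi0QuotEven κ hn K x

/-- **§4.4, the Galois action on `π₀(Sh^V_K)`, `n = 2κ` even, `r = n − r`** (then `E = ℚ`, `𝕊_ℚ = 𝔾_{m,ℚ}`, «`ρ(a) = (1, a)` if
`n = 2k` is even and `r = n−r`», the landed REAL `rhoEvenMiddle`).  Printed (p. 22): the action of `σ ∈ Gal(ℚ̄/ℚ)` on the right side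
of (4.5) is multiplication by `ρ(x_σ)`, `x_σ ∈ 𝔸_ℚ^×` with Artin image `σ∣ℚ^{ab}`.  TYPED over the datum: for every `σ ∈ Aut(ℂ)` and
finite idèle `s` of `ℚ` with ★ `IsArtinCorrespondent ℚ (ℚ → ℂ) s σ`, `(4.5)(σ·x) = [(1, s)] · (4.5)(x)`, `s` pushed into
`𝔸_{k,f}^×` along the tree's ★ `FiniteAdeleRing.baseChange (𝓞 ℚ) ℚ k (𝓞 k)` (`𝔸_{ℚ,f} → 𝔸_{k,f} = k ⊗ 𝔸_{ℚ,f}`).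
[cite: KudlaRapoport2013, §4.4 (arXiv v2 p. 22)] -/
def KR2013_4_4_galoisAction_evenMiddle (D : Sec4Data k) : Prop :=
  ∀ (κ : ℕ) (hn : D.n = 2 * κ), 2 * D.r = D.n → ∀ (K : Level k D.n), D.IsLevel K →
    ∀ (σ : ℂ ≃+* ℂ) (s : (FiniteAdeleRing (𝓞 ℚ) ℚ)ˣ), IsArtinCorrespondent ℚ (algebraMap ℚ ℂ) s σ →
      ∀ x : D.pi0 K,
        D.pi0QuotEven κ hn K (D.galAct K σ x) =
          (QuotientGroup.mk
              (rhoEvenMiddle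
                (Units.map (FiniteAdeleRing.baseChange (𝓞 ℚ) ℚ k (𝓞 k) :
                  FiniteAdeleRing (𝓞 ℚ) ℚ →* FiniteAdeleRing (𝓞 k) k) s)) : Pi0QuotEven k (conj ℚ k) κ K) *
            D.pi0QuotEven κ hn K x

end Galois

/-! ## Proposition 4.4 over the §2 carriers (`Sec2Defs`, seat TKR-t01) — appended once `Sec2Defs` landed -/

section Prop44Sec2

open Literature.AlgebraicGeometry.ShimuraVarieties.KudlaRapoport2013.Sec2Defs (Sec2Core)

variable {k : Type} [Field k] [NumberField k] [IsTotallyComplex k] [Algebra.IsQuadraticExtension ℚ k]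

/-- **Proposition 4.4, instantiated on the tree's §2 carriers** (★ `KudlaRapoport2013.Sec2Defs`): the moduli side of
`KR2013_4_4_comparison` is taken to be the objects `C.Obj g` of `𝓜(n−r,r)(S)` (Def. 2.4; `C : Sec2Core k` with `C.n = D.n`,
`C.r = D.r`), their isomorphisms `NaiveObj.Iso` (§2.1: `𝒪_k`-linear isomorphisms of abelian schemes respecting `λ`), and the component
`𝓜(n−r,r)^{V♯}` cut out by the labels of Prop. 2.12 ∕ 2.19 (`D₂ : C.Sec2Data`): «`x` lies in the component of `V♯`» =
`(D₂.labelSharp g x).StrictSim P` (strict similarity of pairs, Def. 2.18 ∕ Prop. 2.19 (i)), for the pair `P = V♯ = (V, [[L]]) : C.RelevantSharp`.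
The identification of the abstract pair `P` with the datum's coordinates is carried by the hypotheses: `h : P.V.n = D.n`, the Gram
matrix of `P.V` in ★ `HermSpace.basis` is `D.J` (`hJ`), and `L ⊂ kⁿ` is the coordinate image of the self-dual lattice `P.L` (`hL`) — then
`K♯ = K_L` (`Sec4Data.stabilizerLevel`).  Printed statement and WEAKER-THAN-PRINT reading as in `KR2013_4_4_comparison`.
[cite: KudlaRapoport2013, Proposition 4.4 (arXiv v2 p. 20)] -/
def KR2013_4_4_comparison_sec2 (D : Sec4Data k) (C : Sec2Core k) (D₂ : C.Sec2Data) (P : C.RelevantSharp)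
    (L : Submodule (𝓞 k) (Fin D.n → k)) : Prop :=
  C.n = D.n → C.r = D.r → ∀ h : P.V.n = D.n,
    (P.V.gram.reindex (finCongr h) (finCongr h) = D.J) →
    ((L : Set (Fin D.n → k)) = {v | ∃ x ∈ P.L.carrier, ∀ i, v i = P.V.basis.repr x ((finCongr h).symm i)}) →
      KR2013_4_4_comparison D (fun g => C.Obj g) (fun x y => x.toNaiveObj.Iso y.toNaiveObj)
        (fun {_ g} x => (D₂.labelSharp g x).StrictSim P) L

end Prop44Sec2

end Literature.AlgebraicGeometry.ShimuraVarieties.KudlaRapoport2013.Sec4ShimuraComparison
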